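/-
Origin: expansion seat `prover-pub-hodgecm-mc-carch-1-g4-0`, handover #CA31 2026-08-20T07:57Z md5 a8ca22738cff (280 l., 29 decls; NEW additive leaf; imports #CA30 (this kit) + installed vendored NumberTheory/Automorphic/UnitaryGroupAutomorphicRep; RUN 44; INSTALL after #CA30; cert certs/ax-ArchUnitaryFormDetChar-a8ca22738cff.log: rc 0 / 9 s / 0 warnings / 29/29 trio) (`HOME/mc/pub-hodgecm-mc-carch-1/pkg44/HodgeCM/Model/ArchUnitaryFormDetChar.lean`, md5 a8ca22738cff, 280 lines);
landed by the second packager p2 gen 4 (p2-g4) in gate run 44 as `HodgeCM/Model/ArchUnitaryFormDetChar.lean` (verbatim).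
-/
/-
Copyright (c) 2026. Released under Apache 2.0 license as described in the file LICENSE.
Cell pub-hodgecm, MODEL layer (construction prover mc-carch-1, gen 4), BINDER-OWNERS row 12 `C`, junction (C-Λ), item (G1):
abelian characters of `U(H)`, `H` a real diagonal DEFINITE `3 × 3` matrix (the archimedean local group at a definite place), are `det^m`.
-/
import Summits.HodgeConjecture.HodgeCM.Model.ArchUnitaryDetChar_2
import Literature.NumberTheory.Automorphic.UnitaryGroupAutomorphicRep

/-!
# `U(H)` for `H` real diagonal definite: every continuous abelian character is a power of `det`

`U(H) = unitaryGroupOfForm conj (diagonal h) ≤ GL₃(ℂ)` (`Literature.NumberTheory.Automorphic.unitaryGroupOfForm`; for `h = σ_w ∘ frameD V` this is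
the archimedean local group `archLocal … (cmPlaceOver b)` of the C lane's (c5) input at a DEFINITE real place `b`).  With `D = diag(√|hᵢ|)` and the common
sign `s` (`D D = s·H`): `toStd : U(H) →* U(3)`, `g ↦ D g D⁻¹`; `ofStd : U(3) → U(H)`, `u ↦ D⁻¹ u D` (`ofStd_toStd`, `det_toStd`); `continuous_ofStd_D3`;
and **`exists_zpow_of_continuous_form`**: every continuous `χ : U(H) →* ℂˣ` is `g ↦ det(g)^m` for ONE integer `m` (from the sibling's
`U3Char.exists_zpow_of_continuous3`).  Kernel only: 0 records, 0 `def … : Prop`, nothing cited as a hypothesis.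
-/

set_option autoImplicit false

noncomputable section

open scoped Matrix
open ComplexConjugate Complex
open Literature.NumberTheory.Automorphic

namespace HodgeCM.Model.U3FormChar

open HodgeCM.Model.U21Char (conj_mul_self_of_unitary circleToUnitary coe_circleToUnitary)
open HodgeCM.Model.U3Char (D3 coe_D3 exists_zpow_of_continuous3)

/-! ## § 3 `U(H)` for a real diagonal DEFINITE `H`: the scaling to `U(3)` and the `det^m` theorem -/

section Form

variable (h : Fin 3 → ℂ) (hreal : ∀ i, (((h i).re : ℝ) : ℂ) = h i) (hsign : (∀ i, 0 < (h i).re) ∨ ∀ i, (h i).re < 0)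

/-- the common sign `s = ±1` of the entries. -/
def sgn : ℝ := if 0 < (h 0).re then 1 else -1

include hsign in
/-- (Ported verbatim from the HodgeCMPerL package; no docstring in the source.) -/
theorem abs_re_eq (i : Fin 3) : |(h i).re| = sgn h * (h i).re := by
  unfold sgn
  rcases hsign with hp | hn
  · rw [if_pos (hp 0), one_mul, abs_of_pos (hp i)]
  · rw [if_neg (not_lt.mpr (hn 0).le), abs_of_neg (hn i)]; ring

/-- (Ported verbatim from the HodgeCMPerL package; no docstring in the source.) -/
theorem sgn_mul_sgn : sgn h * sgn h = 1 := by
  unfold sgn; split_ifs <;> norm_num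

include hsign in
/-- (Ported verbatim from the HodgeCMPerL package; no docstring in the source.) -/
theorem re_ne_zero (i : Fin 3) : (h i).re ≠ 0 := by
  rcases hsign with hp | hn
  · exact (hp i).ne'
  · exact (hn i).ne

/-- the scaling entries `dᵢ = √|hᵢ|` (as complex numbers). -/
def dvec (i : Fin 3) : ℂ := ((Real.sqrt |(h i).re| : ℝ) : ℂ)

include hsign in
/-- (Ported verbatim from the HodgeCMPerL package; no docstring in the source.) -/
theorem dvec_ne_zero (i : Fin 3) : dvec h i ≠ 0 := by
  unfold dvec
  exact_mod_cast (Real.sqrt_pos.mpr (abs_pos.mpr (re_ne_zero h hsign i))).ne'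

/-- (Ported verbatim from the HodgeCMPerL package; no docstring in the source.) -/
theorem conj_dvec (i : Fin 3) : conj (dvec h i) = dvec h i := by unfold dvec; exact Complex.conj_ofReal _

include hreal hsign in
/-- `dᵢ² = s · hᵢ`. -/
theorem dvec_mul_dvec (i : Fin 3) : dvec h i * dvec h i = (sgn h : ℂ) * h i := by
  unfold dvec
  rw [← Complex.ofReal_mul, Real.mul_self_sqrt (abs_nonneg _), abs_re_eq h hsign i, Complex.ofReal_mul, hreal i]

/-- `D = diag(d)`, `D' = diag(d⁻¹)`. -/
def Dmat : Matrix (Fin 3) (Fin 3) ℂ := Matrix.diagonal (dvec h)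
/-- the inverse scaling. -/
def Dinv : Matrix (Fin 3) (Fin 3) ℂ := Matrix.diagonal fun i => (dvec h i)⁻¹

include hsign in
/-- (Ported verbatim from the HodgeCMPerL package; no docstring in the source.) -/
theorem Dmat_mul_Dinv : Dmat h * Dinv h = 1 := by
  rw [Dmat, Dinv, Matrix.diagonal_mul_diagonal, ← Matrix.diagonal_one]
  congr 1; funext i; rw [mul_inv_cancel₀ (dvec_ne_zero h hsign i)]

include hsign in
/-- (Ported verbatim from the HodgeCMPerL package; no docstring in the source.) -/
theorem Dinv_mul_Dmat : Dinv h * Dmat h = 1 := by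
  rw [Dmat, Dinv, Matrix.diagonal_mul_diagonal, ← Matrix.diagonal_one]
  congr 1; funext i; rw [inv_mul_cancel₀ (dvec_ne_zero h hsign i)]

include hreal hsign in
/-- `D D = s · H`. -/
theorem Dmat_mul_Dmat : Dmat h * Dmat h = (sgn h : ℂ) • Matrix.diagonal h := by
  rw [Dmat, Matrix.diagonal_mul_diagonal, ← Matrix.diagonal_smul]
  congr 1; funext i; rw [dvec_mul_dvec h hreal hsign i, Pi.smul_apply, smul_eq_mul]

include hreal hsign in
/-- `D' H D' = s · 1`. -/
theorem Dinv_mul_H_mul_Dinv : Dinv h * Matrix.diagonal h * Dinv h = (sgn h : ℂ) • (1 : Matrix (Fin 3) (Fin 3) ℂ) := by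
  rw [Dinv, Matrix.diagonal_mul_diagonal, Matrix.diagonal_mul_diagonal, ← Matrix.diagonal_one, ← Matrix.diagonal_smul]
  congr 1; funext i
  have hd := dvec_mul_dvec h hreal hsign i
  have hs : (sgn h : ℂ) * (sgn h : ℂ) = 1 := by exact_mod_cast sgn_mul_sgn h
  have hdi := dvec_ne_zero h hsign i
  rw [Pi.smul_apply, smul_eq_mul, mul_one]
  field_simp
  linear_combination (-(sgn h : ℂ)) * hd + (-(h i)) * hs

/-- (Ported verbatim from the HodgeCMPerL package; no docstring in the source.) -/
theorem conjTranspose_Dmat : (Dmat h)ᴴ = Dmat h := by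
  rw [Dmat, Matrix.diagonal_conjTranspose]; congr 1; funext i; exact conj_dvec h i

/-- (Ported verbatim from the HodgeCMPerL package; no docstring in the source.) -/
theorem conjTranspose_Dinv : (Dinv h)ᴴ = Dinv h := by
  rw [Dinv, Matrix.diagonal_conjTranspose]; congr 1; funext i
  rw [Pi.star_apply, star_inv₀, Complex.star_def, conj_dvec]

/-- membership in `U(H)` through the conjugate transpose. -/
theorem mem_form_iff (g : GL (Fin 3) ℂ) :
    g ∈ unitaryGroupOfForm (starRingEnd ℂ) (Matrix.diagonal h) ↔
      (g : Matrix (Fin 3) (Fin 3) ℂ)ᴴ * Matrix.diagonal h * (g : Matrix (Fin 3) (Fin 3) ℂ) = Matrix.diagonal h := by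
  rw [Matrix.conjTranspose, Matrix.transpose_map]
  rfl

/-- **the scaling `g ↦ D g D⁻¹ : U(H) →* U(3)`.** -/
def toStd : ↥(unitaryGroupOfForm (starRingEnd ℂ) (Matrix.diagonal h)) →* Matrix.unitaryGroup (Fin 3) ℂ where
  toFun g := ⟨Dmat h * (g : GL (Fin 3) ℂ) * Dinv h, by
    rw [Matrix.mem_unitaryGroup_iff', Matrix.star_eq_conjTranspose, Matrix.conjTranspose_mul, Matrix.conjTranspose_mul,
      conjTranspose_Dmat, conjTranspose_Dinv]
    have hg := (mem_form_iff h (g : GL (Fin 3) ℂ)).mp g.2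
    calc Dinv h * (((g : GL (Fin 3) ℂ) : Matrix (Fin 3) (Fin 3) ℂ)ᴴ * Dmat h) * (Dmat h * (g : GL (Fin 3) ℂ) * Dinv h)
        = Dinv h * ((((g : GL (Fin 3) ℂ) : Matrix (Fin 3) (Fin 3) ℂ)ᴴ * (Dmat h * Dmat h) * (g : GL (Fin 3) ℂ))) * Dinv h := by
          simp only [Matrix.mul_assoc]
      _ = (sgn h : ℂ) • (Dinv h * Matrix.diagonal h * Dinv h) := by
          rw [Dmat_mul_Dmat h hreal hsign, Matrix.mul_smul, Matrix.smul_mul, hg, Matrix.mul_smul, Matrix.smul_mul, Matrix.mul_assoc]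
      _ = 1 := by
          rw [Dinv_mul_H_mul_Dinv h hreal hsign, smul_smul]
          rw [show (sgn h : ℂ) * (sgn h : ℂ) = 1 by exact_mod_cast sgn_mul_sgn h, one_smul]⟩
  map_one' := Subtype.ext (by
    change Dmat h * ((1 : GL (Fin 3) ℂ) : Matrix (Fin 3) (Fin 3) ℂ) * Dinv h = 1
    rw [Units.val_one, Matrix.mul_one, Dmat_mul_Dinv h hsign])
  map_mul' a b := Subtype.ext (by
    change Dmat h * ((a * b : GL (Fin 3) ℂ) : Matrix (Fin 3) (Fin 3) ℂ) * Dinv h =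
      Dmat h * (a : GL (Fin 3) ℂ) * Dinv h * (Dmat h * (b : GL (Fin 3) ℂ) * Dinv h)
    rw [Units.val_mul]
    symm
    calc Dmat h * (a : GL (Fin 3) ℂ) * Dinv h * (Dmat h * (b : GL (Fin 3) ℂ) * Dinv h)
        = Dmat h * (a : GL (Fin 3) ℂ) * (Dinv h * Dmat h) * (b : GL (Fin 3) ℂ) * Dinv h := by simp only [Matrix.mul_assoc]
      _ = _ := by rw [Dinv_mul_Dmat h hsign, Matrix.mul_one]; simp only [Matrix.mul_assoc])

/-- (Ported verbatim from the HodgeCMPerL package; no docstring in the source.) -/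
theorem coe_toStd (g : ↥(unitaryGroupOfForm (starRingEnd ℂ) (Matrix.diagonal h))) :
    (toStd h hreal hsign g : Matrix (Fin 3) (Fin 3) ℂ) = Dmat h * (g : GL (Fin 3) ℂ) * Dinv h := rfl

/-- the matrix `D⁻¹ u D` as an invertible matrix. -/
def ofStdGL (u : Matrix.unitaryGroup (Fin 3) ℂ) : GL (Fin 3) ℂ where
  val := Dinv h * (u : Matrix (Fin 3) (Fin 3) ℂ) * Dmat h
  inv := Dinv h * star (u : Matrix (Fin 3) (Fin 3) ℂ) * Dmat h
  val_inv := by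
    calc Dinv h * (u : Matrix (Fin 3) (Fin 3) ℂ) * Dmat h * (Dinv h * star (u : Matrix (Fin 3) (Fin 3) ℂ) * Dmat h)
        = Dinv h * ((u : Matrix (Fin 3) (Fin 3) ℂ) * (Dmat h * Dinv h) * star (u : Matrix (Fin 3) (Fin 3) ℂ)) * Dmat h := by
          simp only [Matrix.mul_assoc]
      _ = 1 := by
          rw [Dmat_mul_Dinv h hsign, Matrix.mul_one, Matrix.mem_unitaryGroup_iff.mp u.2, Matrix.mul_one, Dinv_mul_Dmat h hsign]
  inv_val := by
    calc Dinv h * star (u : Matrix (Fin 3) (Fin 3) ℂ) * Dmat h * (Dinv h * (u : Matrix (Fin 3) (Fin 3) ℂ) * Dmat h)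
        = Dinv h * (star (u : Matrix (Fin 3) (Fin 3) ℂ) * (Dmat h * Dinv h) * (u : Matrix (Fin 3) (Fin 3) ℂ)) * Dmat h := by
          simp only [Matrix.mul_assoc]
      _ = 1 := by
          rw [Dmat_mul_Dinv h hsign, Matrix.mul_one, Matrix.mem_unitaryGroup_iff'.mp u.2, Matrix.mul_one, Dinv_mul_Dmat h hsign]

/-- (Ported verbatim from the HodgeCMPerL package; no docstring in the source.) -/
theorem coe_ofStdGL (u : Matrix.unitaryGroup (Fin 3) ℂ) :
    ((ofStdGL h hsign u : GL (Fin 3) ℂ) : Matrix (Fin 3) (Fin 3) ℂ) = Dinv h * (u : Matrix (Fin 3) (Fin 3) ℂ) * Dmat h := rfl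

include hreal in
/-- (Ported verbatim from the HodgeCMPerL package; no docstring in the source.) -/
theorem ofStdGL_mem (u : Matrix.unitaryGroup (Fin 3) ℂ) : ofStdGL h hsign u ∈ unitaryGroupOfForm (starRingEnd ℂ) (Matrix.diagonal h) := by
  rw [mem_form_iff, coe_ofStdGL, Matrix.conjTranspose_mul, Matrix.conjTranspose_mul, conjTranspose_Dmat, conjTranspose_Dinv,
    ← Matrix.star_eq_conjTranspose]
  calc Dmat h * (star (u : Matrix (Fin 3) (Fin 3) ℂ) * Dinv h) * Matrix.diagonal h * (Dinv h * (u : Matrix (Fin 3) (Fin 3) ℂ) * Dmat h)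
      = Dmat h * (star (u : Matrix (Fin 3) (Fin 3) ℂ) * (Dinv h * Matrix.diagonal h * Dinv h) * (u : Matrix (Fin 3) (Fin 3) ℂ)) * Dmat h := by
        simp only [Matrix.mul_assoc]
    _ = Matrix.diagonal h := by
        rw [Dinv_mul_H_mul_Dinv h hreal hsign, Matrix.mul_smul, Matrix.smul_mul, Matrix.mul_one, Matrix.mem_unitaryGroup_iff'.mp u.2,
          Matrix.mul_smul, Matrix.smul_mul, Matrix.mul_one, Dmat_mul_Dmat h hreal hsign, smul_smul,
          show (sgn h : ℂ) * (sgn h : ℂ) = 1 by exact_mod_cast sgn_mul_sgn h, one_smul]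

/-- **the inverse scaling `u ↦ D⁻¹ u D : U(3) → U(H)`** (a map; it inverts `toStd`). -/
def ofStd (u : Matrix.unitaryGroup (Fin 3) ℂ) : ↥(unitaryGroupOfForm (starRingEnd ℂ) (Matrix.diagonal h)) :=
  ⟨ofStdGL h hsign u, ofStdGL_mem h hreal hsign u⟩

/-- (Ported verbatim from the HodgeCMPerL package; no docstring in the source.) -/
theorem ofStd_toStd (g : ↥(unitaryGroupOfForm (starRingEnd ℂ) (Matrix.diagonal h))) :
    ofStd h hreal hsign (toStd h hreal hsign g) = g := by
  apply Subtype.ext; apply Units.ext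
  change Dinv h * (Dmat h * ((g : GL (Fin 3) ℂ) : Matrix (Fin 3) (Fin 3) ℂ) * Dinv h) * Dmat h = (g : GL (Fin 3) ℂ)
  calc Dinv h * (Dmat h * ((g : GL (Fin 3) ℂ) : Matrix (Fin 3) (Fin 3) ℂ) * Dinv h) * Dmat h
      = (Dinv h * Dmat h) * ((g : GL (Fin 3) ℂ) : Matrix (Fin 3) (Fin 3) ℂ) * (Dinv h * Dmat h) := by simp only [Matrix.mul_assoc]
    _ = _ := by rw [Dinv_mul_Dmat h hsign, Matrix.one_mul, Matrix.mul_one]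

/-- (Ported verbatim from the HodgeCMPerL package; no docstring in the source.) -/
theorem det_toStd (g : ↥(unitaryGroupOfForm (starRingEnd ℂ) (Matrix.diagonal h))) :
    (toStd h hreal hsign g : Matrix (Fin 3) (Fin 3) ℂ).det = ((g : GL (Fin 3) ℂ) : Matrix (Fin 3) (Fin 3) ℂ).det := by
  rw [coe_toStd, Matrix.det_mul, Matrix.det_mul, mul_comm (Matrix.det (Dmat h)), mul_assoc, ← Matrix.det_mul,
    Dmat_mul_Dinv h hsign, Matrix.det_one, mul_one]

/-- the matrix of `ofStd (diag(w, 1, 1))` is `diag(w, 1, 1)` (diagonal matrices commute). -/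
theorem val_ofStdGL_D3 (w : unitary ℂ) :
    ((ofStdGL h hsign (D3 w) : GL (Fin 3) ℂ) : Matrix (Fin 3) (Fin 3) ℂ) = Matrix.diagonal ![(w : ℂ), 1, 1] := by
  rw [coe_ofStdGL]
  have hD3 : ((D3 w : Matrix.unitaryGroup (Fin 3) ℂ) : Matrix (Fin 3) (Fin 3) ℂ) = Matrix.diagonal ![(w : ℂ), 1, 1] := by
    rw [coe_D3]; ext i j; fin_cases i <;> fin_cases j <;> simp
  rw [hD3, Dinv, Dmat, Matrix.diagonal_mul_diagonal, Matrix.diagonal_mul_diagonal]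
  congr 1; funext i
  rw [mul_comm, ← mul_assoc, mul_inv_cancel₀ (dvec_ne_zero h hsign i), one_mul]

/-- … and the matrix of its inverse is `diag(w̄, 1, 1)`. -/
theorem val_inv_ofStdGL_D3 (w : unitary ℂ) :
    (((ofStdGL h hsign (D3 w))⁻¹ : GL (Fin 3) ℂ) : Matrix (Fin 3) (Fin 3) ℂ) = Matrix.diagonal ![conj (w : ℂ), 1, 1] := by
  change Dinv h * star ((D3 w : Matrix.unitaryGroup (Fin 3) ℂ) : Matrix (Fin 3) (Fin 3) ℂ) * Dmat h = _
  have hD3 : star ((D3 w : Matrix.unitaryGroup (Fin 3) ℂ) : Matrix (Fin 3) (Fin 3) ℂ) = Matrix.diagonal ![conj (w : ℂ), 1, 1] := by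
    rw [coe_D3]; ext i j; fin_cases i <;> fin_cases j <;> simp [Matrix.star_apply]
  rw [hD3, Dinv, Dmat, Matrix.diagonal_mul_diagonal, Matrix.diagonal_mul_diagonal]
  congr 1; funext i
  rw [mul_comm, ← mul_assoc, mul_inv_cancel₀ (dvec_ne_zero h hsign i), one_mul]

/-- `z ↦ ofStd (diag(z, 1, 1))` is continuous from the circle into `U(H) ≤ GL₃(ℂ)`. -/
theorem continuous_ofStd_D3 : Continuous fun z : Circle => ofStd h hreal hsign (D3 (circleToUnitary z)) := by
  refine Continuous.subtype_mk ?_ _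
  change Continuous fun z : Circle => ofStdGL h hsign (D3 (circleToUnitary z))
  refine Units.continuous_iff.mpr ⟨?_, ?_⟩
  · have e : (Units.val ∘ fun z : Circle => ofStdGL h hsign (D3 (circleToUnitary z))) =
        fun z : Circle => Matrix.diagonal ![((circleToUnitary z : unitary ℂ) : ℂ), 1, 1] :=
      funext fun z => val_ofStdGL_D3 h hsign (circleToUnitary z)
    rw [e]
    refine continuous_matrix fun i j => ?_
    fin_cases i <;> fin_cases j <;> simp [Matrix.diagonal] <;> first | exact continuous_const | exact continuous_subtype_val
  · have e : (fun z : Circle => (((ofStdGL h hsign (D3 (circleToUnitary z)))⁻¹ : GL (Fin 3) ℂ) : Matrix (Fin 3) (Fin 3) ℂ)) =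
        fun z : Circle => Matrix.diagonal ![conj ((circleToUnitary z : unitary ℂ) : ℂ), 1, 1] :=
      funext fun z => val_inv_ofStdGL_D3 h hsign (circleToUnitary z)
    rw [e]
    refine continuous_matrix fun i j => ?_
    fin_cases i <;> fin_cases j <;> simp [Matrix.diagonal] <;>
      first | exact continuous_const | exact Complex.continuous_conj.comp continuous_subtype_val

include hreal hsign in
/-- **(G1) for `U(H)`, `H` real diagonal definite: every continuous `χ : U(H) →* ℂˣ` is `det^m` for ONE integer `m`.** -/
theorem exists_zpow_of_continuous_form (χ : ↥(unitaryGroupOfForm (starRingEnd ℂ) (Matrix.diagonal h)) →* ℂˣ)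
    (hχ : Continuous fun g : ↥(unitaryGroupOfForm (starRingEnd ℂ) (Matrix.diagonal h)) => ((χ g : ℂˣ) : ℂ)) :
    ∃ m : ℤ, ∀ g : ↥(unitaryGroupOfForm (starRingEnd ℂ) (Matrix.diagonal h)),
      ((χ g : ℂˣ) : ℂ) = (((g : GL (Fin 3) ℂ) : Matrix (Fin 3) (Fin 3) ℂ)).det ^ m := by
  -- the character read on `U(3)`
  let χ' : Matrix.unitaryGroup (Fin 3) ℂ →* ℂˣ :=
    { toFun := fun u => χ (ofStd h hreal hsign u)
      map_one' := by
        have e : ofStd h hreal hsign 1 = 1 := by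
          rw [← map_one (toStd h hreal hsign), ofStd_toStd]
        rw [e, map_one]
      map_mul' := fun a b => by
        have e : ofStd h hreal hsign (a * b) = ofStd h hreal hsign a * ofStd h hreal hsign b := by
          have ha : a = toStd h hreal hsign (ofStd h hreal hsign a) := Subtype.ext (by
            rw [coe_toStd]
            change (a : Matrix (Fin 3) (Fin 3) ℂ) = Dmat h * (Dinv h * (a : Matrix (Fin 3) (Fin 3) ℂ) * Dmat h) * Dinv h
            calc (a : Matrix (Fin 3) (Fin 3) ℂ) = (Dmat h * Dinv h) * a * (Dmat h * Dinv h) := by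
                  rw [Dmat_mul_Dinv h hsign, Matrix.one_mul, Matrix.mul_one]
              _ = _ := by simp only [Matrix.mul_assoc])
          have hb : b = toStd h hreal hsign (ofStd h hreal hsign b) := Subtype.ext (by
            rw [coe_toStd]
            change (b : Matrix (Fin 3) (Fin 3) ℂ) = Dmat h * (Dinv h * (b : Matrix (Fin 3) (Fin 3) ℂ) * Dmat h) * Dinv h
            calc (b : Matrix (Fin 3) (Fin 3) ℂ) = (Dmat h * Dinv h) * b * (Dmat h * Dinv h) := by
                  rw [Dmat_mul_Dinv h hsign, Matrix.one_mul, Matrix.mul_one]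
              _ = _ := by simp only [Matrix.mul_assoc])
          conv_lhs => rw [ha, hb, ← map_mul, ofStd_toStd]
        rw [e, map_mul] }
  have hχ' : Continuous fun z : Circle => ((χ' (D3 (circleToUnitary z)) : ℂˣ) : ℂ) :=
    hχ.comp (continuous_ofStd_D3 h hreal hsign)
  obtain ⟨m, hm⟩ := exists_zpow_of_continuous3 χ' hχ'
  refine ⟨m, fun g => ?_⟩
  have e := hm (toStd h hreal hsign g)
  rw [det_toStd] at e
  rw [← e]
  change ((χ g : ℂˣ) : ℂ) = ((χ (ofStd h hreal hsign (toStd h hreal hsign g)) : ℂˣ) : ℂ)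
  rw [ofStd_toStd]

end Form

end HodgeCM.Model.U3FormChar

end
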